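import Mathlib
import Summits.KontsevichZagierPeriods.Zeta5Search.Elimination.DictStarTop
import Summits.KontsevichZagierPeriods.Zeta5Search.WedgeDictionaryLevelDescentStep
import Summits.KontsevichZagierPeriods.Zeta5Search.WedgeDictionaryGhostFace
import HarnessLib

/-!
# The boundary two-term law for `Q` — PROVED (cell `pub-zeta5`, fam-elim E-L31)

HONEST FRAMING: systematic search; no irrationality claim unless certified.  Identities among gen-1's
rational dictionary data (coefficients `U, W, V`, their slot-7 Plücker coordinate `casUW = U∧W`, the proved
symmetric gauge `ρ`) and Brown–Zudilin's leading coefficient `Q` (`QOf`, [BrownZudilin2022, (17)]) on the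
region; no cellular integral is evaluated, no numerics, nothing moves a record.

OUR work (Summit side; fam-elim gen 31, 2026-08-22).  At a region point `a` with a ZERO slot `b_m = 0`
(`P = b(a)`, level `N = P₀`), for every slot `i ≠ m` with `P_i ≥ 1`:

  `P_i·(N + 1 − P_i)·Q(a) + fanCoeff(P, i)·Q(a − s_i) = 0`        (`qTwoTerm_boundary`),

i.e. gen-1's STAR relation `WedgeDictionaryThreeTerm.DictStar` at `(a; i, m)` with the zero slot as pivot, whose
middle member `a − s_m` is a ghost point and drops out.  This is the `Q`-side two-term family that fam-elim E-L30
(`Elimination/BoundaryDescent`, staged) isolates as the internally minted node `QTwoTermBoundary`; here it is a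
THEOREM, for every guard (`qTwoTermBoundary_any`; E-L30's node is the instance at the dual cone).  Assembly, all
from tree theorems:
* `twoW_two`: gen-1 g7's two-term relation on the rows `P₇ = 0`, `(d+1)·(U∧W)(P) = Π₂(P)·(U∧W)(P − e₂)`
  (`WedgeDictionaryLevelDescentStep.casUW_twoTerm`, from the face relation `quadM3_face_step`), rewritten with the
  STAR coefficient `π₂(P) = P₂(N+1−P₂)·Π₂(P)` (`starPi_two_of_seven_zero`): `TwoW P 2`;
* `twoW_of_perm`, `two_wedge`: transport to every ordered pair (lowered slot `i`, zero slot `m`) along gen-1's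
  `S₇`-symmetry exactly as in E-L25c (`DictStarTransport.starW_of_perm`: `PencilTransport.cas_permLower`,
  `starPi_permLower`, `permLower_lowerAt`);
* `qTwoTerm_boundary`: the gauge step of E-L25d (`DictStarTop.dictStar_top`): `Q = ρ·(U∧W)` at `a` and `a − s_i`
  (`PencilGauge.dict_values`, the region being closed under `a ↦ a − s_i`, `regionHyp_slotDown`), the slot-step
  gauge law `PencilGauge.rhoB_lower` and the polynomial identity `DictStarTop.starPi_gauge`.
What this is NOT: the law is specific to `U∧W` — by gen 30's exact checks at levels `≤ 5`
(`pub-zeta5-fam-elim/g30/`) the slot-7 wedges `U∧V`, `V∧W` (dictionary coordinates `P̂`, `P`) satisfy no such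
two-term law on the boundary, and `Q` satisfies none at interior points (0 of 4 928 instances); nothing here is a
value of `Q`, no cellular-side (`CT`) statement is touched, and nothing about irrationality.

References: [Zudilin2002c] W. Zudilin, arXiv:math/0206176 (2002), §8; [Brown2014] F. Brown, arXiv:1412.6508;
[BrownZudilin2022] F. Brown, W. Zudilin, arXiv:2210.03391.
-/

open Finset

namespace Summit.KontsevichZagierPeriods.Zeta5Search.Elimination

open Summit.KontsevichZagierPeriods.Zeta5Search.DualSeries (InBox)
open Summit.KontsevichZagierPeriods.Zeta5Search.WedgeDictionary
open Summit.KontsevichZagierPeriods.Zeta5Search.SymmetricGauge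
open Literature.NumberTheory.Irrationality.BrownZudilin2022 (bOfA Converges QOf convergenceForms)

/-! ## 1. The gauge-free two-term relation and the slot pair (2, 7) -/

/-- **The gauge-free boundary two-term relation** at `P`, lowering slot `i`:
`(d(P)+1)·P_i(P₀+1−P_i)·(U∧W)(P) = π_i(P)·(U∧W)(P − e_i)` (a predicate in `P, i`; it holds when some OTHER slot
of `P` vanishes, `two_wedge`). -/
def TwoW (P : ℕ → ℤ) (i : ℕ) : Prop :=
  ((dOf P : ℚ) + 1) * ((P i : ℚ) * ((P 0 : ℚ) + 1 - P i)) * casUW P = starPi P i * casUW (lowerAt P i)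

/-- On the rows `P₇ = 0`: `π₂(P) = P₂·(P₀ + 1 − P₂)·Π₂(P)` (`starPi` against gen-1 g7's `mixedPi2`). -/
theorem starPi_two_of_seven_zero (P : ℕ → ℤ) (h7 : P 7 = 0) :
    starPi P 2 = (P 2 : ℚ) * ((P 0 : ℚ) + 1 - P 2) * mixedPi2 P := by
  simp only [starPi, mixedPi2, prod_range_succ, prod_range_zero, Nat.reduceAdd, h7, Int.cast_zero, sub_zero]
  simp
  ring

/-- **The pair `(2, 7)`.** For `P` in the box with `P₇ = 0`, `d(P) ≥ 0` and `1 ≤ P₂ ≤ P₀`: `TwoW P 2` — gen-1 g7's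
`casUW_twoTerm` (`(d+1)·(U∧W)(P) = Π₂·(U∧W)(P − e₂)`) times `P₂(P₀+1−P₂)`. -/
theorem twoW_two (P : ℕ → ℤ) (hP : InBox P) (h7 : P 7 = 0) (hd : 0 ≤ dOf P) (h2 : 1 ≤ P 2) (h2N : P 2 ≤ P 0) :
    TwoW P 2 := by
  have h := casUW_twoTerm P hP h7 hd h2 h2N
  rw [show lowerSlot P 2 = lowerAt P 2 from rfl] at h
  unfold TwoW
  rw [starPi_two_of_seven_zero P h7]
  linear_combination ((P 2 : ℚ) * ((P 0 : ℚ) + 1 - P 2)) * h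

/-! ## 2. Transport along `S₇` -/

/-- `(σ • P) − e₂ = σ • (P − e_{σ(1)+1})`. -/
theorem lowerAt_permLower_two (σ : Equiv.Perm (Fin 7)) (P : ℕ → ℤ) :
    lowerAt (permLower σ P) 2 = permLower σ (lowerAt P ((σ 1).val + 1)) :=
  (permLower_lowerAt σ P 1).symm

/-- `π₂(σ • P) = π_{σ(1)+1}(P)`. -/
theorem starPi_permLower_two (σ : Equiv.Perm (Fin 7)) (P : ℕ → ℤ) :
    starPi (permLower σ P) 2 = starPi P ((σ 1).val + 1) :=
  starPi_permLower σ P 1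

/-- **Transport along `σ ∈ S₇`.**  `TwoW (σ • P) 2` gives `TwoW P (σ(1)+1)` for `P` in the box with `d(P) ≥ 0`,
all slots `≤ P₀` and `P_{σ(1)+1} ≥ 1`: the slot-7 wedge `U∧W` is `S₇`-invariant (`cas_permLower`) and the
coefficients relabel covariantly (`dOf_permLower`, `starPi_permLower`). -/
theorem twoW_of_perm (σ : Equiv.Perm (Fin 7)) (P : ℕ → ℤ) (hP : InBox P) (hd : 0 ≤ dOf P)
    (hle : ∀ m ∈ Icc 1 7, P m ≤ P 0) (hi1 : 1 ≤ P ((σ 1).val + 1)) (hW : TwoW (permLower σ P) 2) :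
    TwoW P ((σ 1).val + 1) := by
  have h7le : P 7 ≤ P 0 := hle 7 (by simp)
  have hkle : P ((σ 6).val + 1) ≤ P 0 := hle _ (mem_Icc.2 ⟨by omega, by have := (σ 6).isLt; omega⟩)
  have hIi : InBox (lowerAt P ((σ 1).val + 1)) := inBox_lowerAt hP (by omega) hi1
  have hdi : 0 ≤ dOf (lowerAt P ((σ 1).val + 1)) := by rw [dOf_lowerAt P (σ 1).isLt]; omega
  have hsi : lowerAt P ((σ 1).val + 1) ((σ 6).val + 1) ≤ lowerAt P ((σ 1).val + 1) 0 := by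
    rw [lowerAt_zero P (by omega)]; exact (lowerAt_le P _ _).trans hkle
  have h7i : lowerAt P ((σ 1).val + 1) 7 ≤ lowerAt P ((σ 1).val + 1) 0 := by
    rw [lowerAt_zero P (by omega)]; exact (lowerAt_le P _ _).trans h7le
  have eP := cas_permLower σ P hP hd hkle h7le
  have eI := cas_permLower σ _ hIi hdi hsi h7i
  obtain ⟨v0, -, v2, -⟩ := permLower_vals σ P
  unfold TwoW at hW ⊢
  rw [dOf_permLower, lowerAt_permLower_two, starPi_permLower_two, eP.1, eI.1, v0, v2] at hW
  exact hW

/-- **The gauge-free two-term relation in every slot pair.**  For `i ≠ m` in `[1,7]` and `P` in the box with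
`d(P) ≥ 0`, all slots `≤ P₀`, `P_i ≥ 1` and `P_m = 0`: `TwoW P i` (from the pair `(2,7)` by a relabelling `σ`
with `σ(1)+1 = i`, `σ(6)+1 = m`). -/
theorem two_wedge (P : ℕ → ℤ) {i m : ℕ} (hi : i ∈ Icc 1 7) (hm : m ∈ Icc 1 7) (him : i ≠ m) (hP : InBox P)
    (hd : 0 ≤ dOf P) (hle : ∀ n ∈ Icc 1 7, P n ≤ P 0) (hi1 : 1 ≤ P i) (hm0 : P m = 0) : TwoW P i := by
  obtain ⟨hi1', hi7⟩ := mem_Icc.1 hi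
  obtain ⟨hm1', hm7⟩ := mem_Icc.1 hm
  obtain ⟨i', rfl⟩ : ∃ i' : Fin 7, i = i'.val + 1 := ⟨⟨i - 1, by omega⟩, by simp only; omega⟩
  obtain ⟨m', rfl⟩ : ∃ m' : Fin 7, m = m'.val + 1 := ⟨⟨m - 1, by omega⟩, by simp only; omega⟩
  have him' : i' ≠ m' := fun h => him (by rw [h])
  -- a relabelling `σ` with `σ(1) = i'`, `σ(6) = m'`
  have hr : Equiv.swap (1 : Fin 7) i' m' ≠ 1 := fun h => him' (by
    have := congrArg (Equiv.swap (1 : Fin 7) i') h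
    rw [Equiv.swap_apply_self, Equiv.swap_apply_left] at this
    exact this.symm)
  have hσ6 : (Equiv.swap (1 : Fin 7) i' * Equiv.swap 6 (Equiv.swap (1 : Fin 7) i' m')) 6 = m' := by
    rw [Equiv.Perm.mul_apply, Equiv.swap_apply_left, Equiv.swap_apply_self]
  have hσ1 : (Equiv.swap (1 : Fin 7) i' * Equiv.swap 6 (Equiv.swap (1 : Fin 7) i' m')) 1 = i' := by
    rw [Equiv.Perm.mul_apply, Equiv.swap_apply_of_ne_of_ne (by decide) hr.symm, Equiv.swap_apply_left]
  obtain ⟨σ, hσ1, hσ6⟩ : ∃ σ : Equiv.Perm (Fin 7), σ 1 = i' ∧ σ 6 = m' := ⟨_, hσ1, hσ6⟩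
  obtain ⟨v0, -, v2, -, -, -, -, v7⟩ := permLower_vals σ P
  rw [hσ1] at v2
  rw [hσ6] at v7
  have hW : TwoW (permLower σ P) 2 :=
    twoW_two (permLower σ P) (inBox_permLower σ hP) (by rw [v7]; exact hm0) (by rw [dOf_permLower]; exact hd)
      (by rw [v2]; exact hi1) (by rw [v2, v0]; exact hle _ hi)
  have T := twoW_of_perm σ P hP hd hle (by rw [hσ1]; exact hi1) hW
  rw [hσ1] at T
  exact T

/-! ## 3. The gauge: the two-term law for `Q` -/

/-- Scalar skeleton of the gauge step: the gauge-free relation `W`, the slot-step gauge, the polynomial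
identity, `d + 1 ≠ 0` and `χ_i ≠ 0`. -/
theorem twoTop_assemble {dp1 c X0 πi Xi ρ ρi χi Pi Ei fi : ℚ} (hW : dp1 * c * X0 = πi * Xi)
    (hGi : ρi * dp1 * χi = -(Pi * Ei * ρ)) (hSi : Pi * Ei * fi = χi * πi) (hd : dp1 ≠ 0) (hχi : χi ≠ 0) :
    c * (ρ * X0) + fi * (ρi * Xi) = 0 := by
  have key : (dp1 * χi) * (c * (ρ * X0) + fi * (ρi * Xi)) = 0 := by
    linear_combination (χi * ρ) * hW + (fi * Xi) * hGi + (-(ρ * Xi)) * hSi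
  rcases mul_eq_zero.1 key with h | h
  · exact absurd h (mul_ne_zero hd hχi)
  · exact h

/-- **THE BOUNDARY TWO-TERM LAW FOR `Q` (PROVED).**  For a region point `a` (`RegionHyp a j`), slots `i ≠ m` in
`[1,7]` with `b(a)_m = 0` and `b(a)_i ≥ 1`:
`b_i·(b₀ + 1 − b_i)·Q(a) + fanCoeff(b, i)·Q(a − s_i) = 0` (`b = b(a)`) — gen-1's STAR at `(a; i, m)` with the
zero slot as pivot. -/
theorem qTwoTerm_boundary (a : Fin 8 → ℤ) {j i m : ℕ} (H₀ : RegionHyp a j) (hi : i ∈ Icc 1 7)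
    (hm : m ∈ Icc 1 7) (him : i ≠ m) (hm0 : bOfA a m = 0) (hi1 : 1 ≤ bOfA a i) :
    bOfA a i * (bOfA a 0 + 1 - bOfA a i) * QOf a + fanCoeff (bOfA a) i * QOf (a + slotDown i) = 0 := by
  obtain ⟨hi1', hi7⟩ := mem_Icc.1 hi
  have H₂ : RegionHyp (a + slotDown i) j := regionHyp_slotDown H₀ hi hi1
  obtain ⟨hQ0, -, -⟩ := dict_values H₀
  obtain ⟨hQ2, -, -⟩ := dict_values H₂
  obtain ⟨-, hconv, hreg, hd0, -⟩ := H₀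
  have hE : ∀ jk ∈ Epairs, bOfA a jk.1 + bOfA a jk.2 ≤ bOfA a 0 := epairs_le_of_converges a hconv
  have hPs : ∀ n, 1 ≤ n → n ≤ 7 → 0 ≤ bOfA a n ∧ 2 * bOfA a n ≤ bOfA a 0 + 1 := fun n h1 h7 =>
    hreg n (mem_Icc.2 ⟨h1, h7⟩)
  have hN1 : 1 ≤ bOfA a 0 := by
    have := hPs i hi1' hi7
    omega
  have hPI : InBox (bOfA a) := ⟨by omega, fun n hn => by
    have := hPs (n + 1) (by omega) (by have := mem_range.1 hn; omega); omega⟩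
  have hle : ∀ n ∈ Icc 1 7, bOfA a n ≤ bOfA a 0 := fun n hn => by
    obtain ⟨h1, h7⟩ := mem_Icc.1 hn
    have := hPs n h1 h7
    omega
  -- (1) the gauge-free two-term relation at `(P; i)`, zero pivot `m`
  have W := two_wedge (bOfA a) hi hm him hPI hd0 hle hi1 hm0
  unfold TwoW at W
  -- (2) the gauge of the slot step `P ↦ P − e_i` and (3) the polynomial identity at slot `i`
  obtain ⟨si, rfl⟩ : ∃ s, i = s + 1 := ⟨i - 1, by omega⟩
  have Gi : rhoB (lowerAt (bOfA a) (si + 1)) * ((dOf (bOfA a) : ℚ) + 1) * (chiOf (bOfA a) (si + 1) : ℚ) =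
      -((bOfA a (si + 1) : ℚ) * edgeProd (bOfA a) (si + 1) * rhoB (bOfA a)) :=
    rhoB_lower (bOfA a) (show si < 7 by omega) hPI hi1 hd0 hE
  have Si := starPi_gauge (bOfA a) hi
  -- non-vanishing
  have hd : ((dOf (bOfA a) : ℚ) + 1) ≠ 0 := by
    have : (0 : ℚ) ≤ dOf (bOfA a) := by exact_mod_cast hd0
    exact ne_of_gt (by linarith)
  have hχ : (chiOf (bOfA a) (si + 1) : ℚ) ≠ 0 := by
    have h1 : (1 : ℤ) ≤ chiOf (bOfA a) (si + 1) := by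
      unfold chiOf; split_ifs
      · omega
      · exact le_refl _
    have : (1 : ℚ) ≤ chiOf (bOfA a) (si + 1) := by exact_mod_cast h1
    exact ne_of_gt (by linarith)
  -- the lowered point is `P − e_i`
  have hQi : ∀ n, n ≤ 7 → bOfA (a + slotDown (si + 1)) n = lowerAt (bOfA a) (si + 1) n := fun n hn => by
    rw [bOfA_add_slotDown _ _ hi n hn, lowerAt_apply]
    split_ifs with h
    · rw [h]
    · rfl
  rw [rhoOf_eq_rhoB] at hQ0 hQ2
  rw [rhoB_congr hQi, (cas_congr hQi).1] at hQ2
  have hq : ((bOfA a (si + 1) : ℚ) * ((bOfA a 0 : ℚ) + 1 - bOfA a (si + 1))) * (QOf a : ℚ) +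
      (fanCoeff (bOfA a) (si + 1) : ℚ) * (QOf (a + slotDown (si + 1)) : ℚ) = 0 := by
    rw [hQ0, hQ2]
    exact twoTop_assemble W Gi Si hd hχ
  exact_mod_cast hq

/-- **The boundary two-term law for `Q`, for every guard `W` (PROVED).**  At a region point with a zero slot, for
every slot `i` with `b_i ≥ 1`: `b_i(b₀+1−b_i)·Q(a) + fanCoeff(b,i)·Q(a − s_i) = 0` — the shape of fam-elim E-L30's
node `QTwoTermBoundary` (its instance `W = DualCone`), with the guard unused. -/
theorem qTwoTermBoundary_any (W : (Fin 8 → ℤ) → Prop) :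
    ∀ (a : Fin 8 → ℤ) (j i : ℕ), RegionHyp a j → W a → (∃ m ∈ Icc 1 7, bOfA a m = 0) → i ∈ Icc 1 7 →
      1 ≤ bOfA a i →
      bOfA a i * (bOfA a 0 + 1 - bOfA a i) * QOf a + fanCoeff (bOfA a) i * QOf (a + slotDown i) = 0 := by
  intro a j i hr _ hz hi hi1
  obtain ⟨m, hm, hm0⟩ := hz
  have him : i ≠ m := by
    rintro rfl
    omega
  exact qTwoTerm_boundary a hr hi hm him hm0 hi1

end Summit.KontsevichZagierPeriods.Zeta5Search.Elimination
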